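import Literature.MathematicalPhysics.QuantumFieldTheory.Federbush1986.ModeAnalyticityCorrectedGauge
import Literature.MathematicalPhysics.QuantumFieldTheory.Federbush1986.ModeDecayPaleyWiener

/-!
# Federbush–Williamson, *A phase cell approach to Yang–Mills theory. II. Analysis of a mode* (J. Math. Phys. **28**
# (1987) 1416–1419) [FederbushWilliamson1987PhaseCellII] — §VI (3), (6): `e_j` and `1 + g` are INVERTIBLE on a uniform
# tube around the period cell ((6.3), (6.13): «e₁(p) is invertible in 𝒟_L … (1 + g)⁻¹ is analytic»), and the cell
# representatives of the corrected-gauge mode are holomorphic there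

statement-level skeleton of published theorems with citation tags; proofs where landed; nothing here is a claim about
the Yang–Mills mass gap

Cell `lit-balaban`, Phase-2 proof seat **p04** (gen 9), own lane F2 (rows `F2.Thm3.1`–`F2.Thm3.3`, owner r17, referee
ref-5); file 3 of the corrected-gauge programme (`ModeAnalyticityWideTube` → `ModeAnalyticityCorrectedGauge` → this →
`ModeAnalyticityThms31to33Corrected`).  Page READ AS IMAGE: `run/shared/lean/pub/pub-balaban/t4/b2b-balaban-t4-lit2/g7/
fw1987II/fedwill1987-jmp28-II-p003-x2.png` (p. 1418, §VI: «(3) e_i⁻¹(p) is analytic (6.3) … Picking ε′, ε″, and ε̄ small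
enough, and using (6.8), we see e₁(p) is invertible in 𝒟_L and so analytic implying (3) … (6) (1 + g)⁻¹ is analytic
(6.13) … The proof that (1 + g) is invertible, and so analytic, follows quite immediately from the proof above that e₁(p)
is invertible»).

HOW (the honest version of print's «small argument» heuristics).  At the REAL points of the closed period cell every term
of the lattice sum `D_j` is a non-negative real ((6.6)–(6.7) are sums of squares), so `e_j = 1 + p²D_j ≥ 1` and, by the
regrouping (6.11) `Σ_kp_k²∏_{j≠k}e_j = p²(1+g)` (gen-6 `den_eq`), `1 + g ≥ 1` there (§2).  The real cell is compact and
`e_j`, `1 + g` are continuous on the wide tube `Wt` (file 1), so they stay non-zero on a uniform thickening: there is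
`δ₀ ∈ (0, ¼]` with `e_j ≠ 0`, `1 + g ≠ 0` on the tube `{|Re q_j| < π + δ₀, |Im q_j| < δ₀}` (§3, `delta0`; this is the
`ε₀` of Theorem 3.1 — existence by compactness, no explicit value claimed).  §4: on that tube the cell-`0`
representative `G0 s i` of the corrected mode is holomorphic, and on every translated cell `{p : p − 2πm ∈ tube δ₀}`,
`m ≠ 0`, the representative `Gm s m i` is holomorphic (there `Re p² ≥ 5`, `Re(1 + p²) ≥ 6`, `|Re p_j| ≥ 5/2` when
`m_j ≠ 0`).  §1 also fixes the global object of the sequel: the cell index `cellIdx p = round(Re p/2π)` and the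
corrected-gauge mode's global holomorphic representative `gcorr s i p := G0/Gm` on the cell of `p`.

Kernel-checked, axioms standard; `def`s are objects (`tube`, `cellSet`, `realCell`, `ratioR`, `termDR`, `DR`, `delta0`,
`cellIdx`, `gcorr`); no `Prop` definitions, no named facts.
-/

noncomputable section

namespace Literature.MathematicalPhysics.QuantumFieldTheory.Federbush1986

namespace ModeAnalyticityCellPositivity

open ModeAnalyticity ModeAnalyticityLatticeSums ModeAnalyticityBracketSplit ModeAnalyticityGaugeRepair
  ModeAnalyticityWideTube ModeAnalyticityCorrectedGauge ModeDecay Complex Filter Topology Finset Metric Set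
open scoped BigOperators Real

/-! ## §1. Tubes, cells, the cell index and the global representative -/

/-- The tube of width `δ` around the period cell: `{q : |Re q_j| < π + δ, |Im q_j| < δ}` (`𝒟_L(δ)` of (3.2) thickened in
the real directions). [cite: FederbushWilliamson1987PhaseCellII, (3.2) p. 1417] -/
def tube (δ : ℝ) : Set Momentum := {q | ∀ j, |(q j).re| < π + δ ∧ |(q j).im| < δ}

/-- (plumbing) `tube δ ⊆ Wt` for `δ ≤ ½`. [cite: FederbushWilliamson1987PhaseCellII, (3.2) p. 1417] -/
theorem tube_subset_Wt {δ : ℝ} (hδ : δ ≤ 1 / 2) : tube δ ⊆ Wt := fun q hq j =>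
  ⟨(hq j).1.trans_le (by linarith), (hq j).2.trans_le hδ⟩

/-- (plumbing) tubes are monotone in `δ`. [cite: FederbushWilliamson1987PhaseCellII, (3.2) p. 1417] -/
theorem tube_mono {δ δ' : ℝ} (h : δ ≤ δ') : tube δ ⊆ tube δ' := fun q hq j =>
  ⟨(hq j).1.trans_le (by linarith), (hq j).2.trans_le h⟩

/-- (plumbing) `tube δ` is open. [cite: FederbushWilliamson1987PhaseCellII, (3.2) p. 1417] -/
theorem isOpen_tube (δ : ℝ) : IsOpen (tube δ) := by
  have e : tube δ = ⋂ j : Fin 4, {p : Momentum | |(p j).re| < π + δ} ∩ {p | |(p j).im| < δ} := by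
    ext p; simp [tube]
  rw [e]
  refine isOpen_iInter_of_finite fun j => IsOpen.inter ?_ ?_
  · exact isOpen_lt (continuous_abs.comp (Complex.continuous_re.comp (continuous_apply j))) continuous_const
  · exact isOpen_lt (continuous_abs.comp (Complex.continuous_im.comp (continuous_apply j))) continuous_const

/-- (plumbing) `Re`/`Im` of a coordinate are `ℝ`-linear on `ℂ⁴`. [folklore] -/
private theorem isLinearMap_re (j : Fin 4) : IsLinearMap ℝ fun p : Momentum => (p j).re :=
  ⟨fun p q => by simp, fun c p => by simp⟩

/-- (plumbing) [folklore] -/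
private theorem isLinearMap_im (j : Fin 4) : IsLinearMap ℝ fun p : Momentum => (p j).im :=
  ⟨fun p q => by simp, fun c p => by simp⟩

/-- The translated cell `{p : p − 2πm ∈ tube δ}` around `2πm` ((3.1)). [cite: FederbushWilliamson1987PhaseCellII, (3.1)–(3.2)
p. 1417] -/
def cellSet (m : Idx) (δ : ℝ) : Set Momentum := {p | unshift m p ∈ tube δ}

/-- (plumbing) membership in a translated cell, in coordinates. [cite: FederbushWilliamson1987PhaseCellII, (3.1)–(3.2) p. 1417] -/
theorem mem_cellSet_iff {m : Idx} {δ : ℝ} {p : Momentum} :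
    p ∈ cellSet m δ ↔ ∀ j, |(p j).re - 2 * π * (m j : ℝ)| < π + δ ∧ |(p j).im| < δ := by
  have hre : ∀ j, (unshift m p j).re = (p j).re - 2 * π * (m j : ℝ) := fun j => by
    simp [unshift, Complex.sub_re, Complex.mul_re]
  have him : ∀ j, (unshift m p j).im = (p j).im := fun j => by
    simp [unshift, Complex.sub_im, Complex.mul_im]
  simp only [cellSet, tube, Set.mem_setOf_eq, hre, him]

/-- (plumbing) the cell `m = 0` is the tube itself. [cite: FederbushWilliamson1987PhaseCellII, (3.2) p. 1417] -/
theorem cellSet_zero (δ : ℝ) : cellSet 0 δ = tube δ := by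
  ext p; simp [cellSet, unshift_zero]

/-- (plumbing) translated cells are CONVEX (boxes in `ℝ⁸`), hence preconnected — the identity theorem applies on them and
on their pairwise intersections. [cite: FederbushWilliamson1987PhaseCellII, (3.1)–(3.2) p. 1417] -/
theorem convex_cellSet (m : Idx) (δ : ℝ) : Convex ℝ (cellSet m δ) := by
  have e : cellSet m δ = ⋂ j : Fin 4, ({p : Momentum | (p j).re < 2 * π * (m j : ℝ) + (π + δ)} ∩
      {p | 2 * π * (m j : ℝ) - (π + δ) < (p j).re}) ∩ ({p | (p j).im < δ} ∩ {p | -δ < (p j).im}) := by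
    ext p
    simp only [mem_cellSet_iff, abs_lt, Set.mem_iInter, Set.mem_inter_iff, Set.mem_setOf_eq]
    refine forall_congr' fun j => ?_
    constructor
    · rintro ⟨⟨h1, h2⟩, h3, h4⟩; exact ⟨⟨by linarith, by linarith⟩, h4, h3⟩
    · rintro ⟨⟨h1, h2⟩, h3, h4⟩; exact ⟨⟨by linarith, by linarith⟩, h4, h3⟩
  rw [e]
  exact convex_iInter fun j => ((convex_halfSpace_lt (isLinearMap_re j) _).inter
    (convex_halfSpace_gt (isLinearMap_re j) _)).inter
    ((convex_halfSpace_lt (isLinearMap_im j) _).inter (convex_halfSpace_gt (isLinearMap_im j) _))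

/-- (plumbing) `unshift m` as a translation of `ℂ⁴`. [cite: FederbushWilliamson1987PhaseCellII, (3.1) p. 1417] -/
theorem unshift_eq (m : Idx) : unshift m = fun p : Momentum => p - fun j => 2 * π * (m j : ℂ) := by
  funext p j; simp [unshift]

/-- (plumbing) `unshift m` is continuous (indeed affine). [cite: FederbushWilliamson1987PhaseCellII, (3.1) p. 1417] -/
theorem differentiable_unshift (m : Idx) : Differentiable ℂ (unshift m) := by
  rw [unshift_eq]; exact differentiable_id.sub (differentiable_const _)

/-- (plumbing) translated cells are open. [cite: FederbushWilliamson1987PhaseCellII, (3.1)–(3.2) p. 1417] -/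
theorem isOpen_cellSet (m : Idx) (δ : ℝ) : IsOpen (cellSet m δ) :=
  (isOpen_tube δ).preimage (differentiable_unshift m).continuous

/-- The CELL INDEX of a momentum: `m_j = round(Re p_j/(2π))`, so that `p − 2πm` lies in the closed period cell
`|Re q_j| ≤ π` ((3.1): every `p` is a lattice translate of a point of `𝒟_L`). [cite: FederbushWilliamson1987PhaseCellII,
(3.1)–(3.2) p. 1417] -/
def cellIdx (p : Momentum) : Idx := fun j => round ((p j).re / (2 * π))

/-- `|Re(p − 2π·cellIdx p)_j| ≤ π`. [cite: FederbushWilliamson1987PhaseCellII, (3.1)–(3.2) p. 1417] -/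
theorem abs_re_unshift_cellIdx_le (p : Momentum) (j : Fin 4) : |(unshift (cellIdx p) p j).re| ≤ π := by
  have hre : (unshift (cellIdx p) p j).re = (p j).re - 2 * π * (round ((p j).re / (2 * π)) : ℝ) := by
    simp [unshift, cellIdx, Complex.sub_re, Complex.mul_re]
  rw [hre]
  have h := abs_sub_round ((p j).re / (2 * π))
  have hπ : (0 : ℝ) < 2 * π := by positivity
  have e : (p j).re - 2 * π * (round ((p j).re / (2 * π)) : ℝ) =
      (2 * π) * ((p j).re / (2 * π) - round ((p j).re / (2 * π))) := by field_simp
  rw [e, abs_mul, abs_of_pos hπ]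
  nlinarith

/-- (plumbing) `Im(p − 2πm)_j = Im p_j`. [cite: FederbushWilliamson1987PhaseCellII, (3.1) p. 1417] -/
theorem unshift_im (m : Idx) (p : Momentum) (j : Fin 4) : (unshift m p j).im = (p j).im := by
  simp [unshift, Complex.sub_im, Complex.mul_im]

/-- Every `p` of the strip `|Im p_j| < δ` lies in the translated cell of its cell index ((3.1)).
[cite: FederbushWilliamson1987PhaseCellII, (3.1)–(3.3) p. 1417] -/
theorem mem_cellSet_cellIdx {δ : ℝ} (hδ : 0 < δ) {p : Momentum} (hp : p ∈ DG δ) : p ∈ cellSet (cellIdx p) δ := by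
  intro j
  refine ⟨?_, ?_⟩
  · have := abs_re_unshift_cellIdx_le p j; linarith
  · rw [unshift_im]; exact hp j

/-- **The global holomorphic representative of the corrected-gauge mode**: on the cell of `p`, the cell representative —
`G0` on the home cell (`cellIdx p = 0`), `Gm (cellIdx p)` on the translated ones.  (That the choice of cell does not matter
on overlaps, and that this IS `Â_i` at the real generic momenta, is the business of the sequel.)
[cite: FederbushWilliamson1987PhaseCellII, Theorems 3.1–3.2 p. 1417, (5.1)–(5.10) p. 1417–1418] -/
def gcorr (s : ℕ) (i : Fin 4) (p : Momentum) : ℂ :=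
  if cellIdx p = 0 then G0 s i p else Gm s (cellIdx p) i p

/-! ## §2. Positivity at the real points of the cell: `e_j ≥ 1`, `1 + g ≥ 1` -/

/-- Real form of the factor `p_i²/(p_i + 2πn_i)²` (or `1`). [cite: FederbushWilliamson1987PhaseCellII, (6.6)–(6.7) p. 1418] -/
def ratioR (n : Idx) (x : Fin 4 → ℝ) (i : Fin 4) : ℝ := if n i = 0 then 1 else (x i) ^ 2 / (x i + 2 * π * (n i : ℝ)) ^ 2

/-- Real form of one term of `D_j`. [cite: FederbushWilliamson1987PhaseCellII, (6.5)–(6.7) p. 1418] -/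
def termDR (j : Fin 4) (n : Idx) (x : Fin 4 → ℝ) : ℝ :=
  (∏ i, ratioR n x i) * ratioR n x j / ∑ l, (x l + 2 * π * (n l : ℝ)) ^ 2

/-- Real form of `D_j` at a real momentum. [cite: FederbushWilliamson1987PhaseCellII, (5.3), (6.5) p. 1418] -/
def DR (j : Fin 4) (x : Fin 4 → ℝ) : ℝ := ∑' n : NZ, termDR j n.1 x

/-- (plumbing) the terms of `D_j` are non-negative reals at real momenta ((6.6)–(6.7) are sums of squares).
[cite: FederbushWilliamson1987PhaseCellII, (6.6)–(6.7) p. 1418] -/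
theorem ratioR_nonneg (n : Idx) (x : Fin 4 → ℝ) (i : Fin 4) : 0 ≤ ratioR n x i := by
  unfold ratioR; split_ifs <;> positivity

/-- (plumbing) [cite: FederbushWilliamson1987PhaseCellII, (6.6)–(6.7) p. 1418] -/
theorem termDR_nonneg (j : Fin 4) (n : Idx) (x : Fin 4 → ℝ) : 0 ≤ termDR j n x := by
  unfold termDR
  refine div_nonneg (mul_nonneg (Finset.prod_nonneg fun i _ => ratioR_nonneg n x i) (ratioR_nonneg n x j)) ?_
  exact Finset.sum_nonneg fun l _ => sq_nonneg _

/-- (plumbing) `D_j ≥ 0` at real momenta. [cite: FederbushWilliamson1987PhaseCellII, (6.5)–(6.8) p. 1418] -/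
theorem DR_nonneg (j : Fin 4) (x : Fin 4 → ℝ) : 0 ≤ DR j x := tsum_nonneg fun n => termDR_nonneg j n.1 x

/-- (plumbing) the complex factor at a real momentum is the real one. [cite: FederbushWilliamson1987PhaseCellII, (6.6)–(6.7)
p. 1418] -/
theorem ratio_toC (n : Idx) (x : Fin 4 → ℝ) (i : Fin 4) : ratio n (toC x) i = (ratioR n x i : ℂ) := by
  unfold ratio ratioR
  split_ifs with h
  · simp
  · simp only [shift_apply, toC]; push_cast; ring

/-- (plumbing) [cite: FederbushWilliamson1987PhaseCellII, (6.6)–(6.7) p. 1418] -/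
theorem csq_shift_toC (n : Idx) (x : Fin 4 → ℝ) :
    csq (shift (toC x) n) = ((∑ l, (x l + 2 * π * (n l : ℝ)) ^ 2 : ℝ) : ℂ) := by
  unfold csq; simp only [shift_apply, toC]; push_cast; rfl

/-- (plumbing) `termD_j(n, x) = termDR_j(n, x)` at a real momentum `x`. [cite: FederbushWilliamson1987PhaseCellII, (6.5)–(6.7)
p. 1418] -/
theorem termD_toC (j : Fin 4) (n : Idx) (x : Fin 4 → ℝ) : termD j n (toC x) = (termDR j n x : ℂ) := by
  unfold termD termDR
  simp only [ratio_toC, csq_shift_toC]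
  push_cast
  rfl

/-- **`D_j` is a non-negative real at every real momentum**: `D_j(x) = DR_j(x) ≥ 0`.
[cite: FederbushWilliamson1987PhaseCellII, (5.3), (6.5)–(6.8) p. 1418] -/
theorem D_toC (j : Fin 4) (x : Fin 4 → ℝ) : D j (toC x) = (DR j x : ℂ) := by
  unfold D DR
  simp_rw [termD_toC]
  exact (Complex.ofReal_tsum _).symm

/-- (plumbing) `p²` at a real momentum. [cite: FederbushWilliamson1987PhaseCellII, (1.4) p. 1416] -/
theorem csq_toC (x : Fin 4 → ℝ) : csq (toC x) = ((∑ j, x j ^ 2 : ℝ) : ℂ) :=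
  ModeAnalyticityThm31Refutation.csq_ofReal x

/-- **`e_j = 1 + p²D_j` is a real number `≥ 1` at every real momentum** — the honest form of «e₁(p) is invertible in 𝒟_L»
at the real points. [cite: FederbushWilliamson1987PhaseCellII, (6.3), (6.8) p. 1418] -/
theorem E_toC (j : Fin 4) (x : Fin 4 → ℝ) :
    E j (toC x) = ((1 + (∑ l, x l ^ 2) * DR j x : ℝ) : ℂ) ∧ 1 ≤ 1 + (∑ l, x l ^ 2) * DR j x := by
  refine ⟨?_, ?_⟩
  · unfold E; rw [csq_toC, D_toC]; push_cast; ring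
  · have h1 : 0 ≤ ∑ l, x l ^ 2 := Finset.sum_nonneg fun l _ => sq_nonneg _
    nlinarith [DR_nonneg j x]

/-- `e_j ≠ 0` at the real momenta. [cite: FederbushWilliamson1987PhaseCellII, (6.3) p. 1418] -/
theorem E_toC_ne_zero (j : Fin 4) (x : Fin 4 → ℝ) : E j (toC x) ≠ 0 := by
  rw [(E_toC j x).1]
  have := (E_toC j x).2
  exact_mod_cast (by linarith : (1 + (∑ l, x l ^ 2) * DR j x) ≠ 0)

/-- **`1 + g ≠ 0` at every real momentum** — from (6.11) `Σ_kp_k²∏_{j≠k}e_j = p²(1+g)` with all `e_j ≥ 1`: for `x ≠ 0`,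
`1 + g = (Σ_kx_k²∏_{j≠k}e_j)/x² ≥ 1`; at `x = 0`, `g = 0`. [cite: FederbushWilliamson1987PhaseCellII, (6.11), (6.13)–(6.14)
p. 1418] -/
theorem one_add_ghat_toC_ne_zero (x : Fin 4 → ℝ) : 1 + ghat (toC x) ≠ 0 := by
  set e : Fin 4 → ℝ := fun j => 1 + (∑ l, x l ^ 2) * DR j x with he_def
  have hE : ∀ j, E j (toC x) = (e j : ℂ) := fun j => (E_toC j x).1
  have he : ∀ j, 1 ≤ e j := fun j => (E_toC j x).2
  have hden := den_eq (toC x)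
  set c : ℝ := ∑ l, x l ^ 2 with hc_def
  have hc0 : 0 ≤ c := Finset.sum_nonneg fun l _ => sq_nonneg _
  by_cases hc : c = 0
  · -- `x = 0`, so `ĝ(0) = 0`
    have hx : ∀ j, x j = 0 := fun j => by
      have h := (Finset.sum_eq_zero_iff_of_nonneg fun l _ => sq_nonneg (x l)).mp hc j (Finset.mem_univ j)
      exact pow_eq_zero_iff (n := 2) (by norm_num) |>.mp h
    have h0 : toC x = 0 := funext fun j => by simp [toC, hx j]
    rw [h0]
    simp [ghat]
  · have hcpos : 0 < c := lt_of_le_of_ne hc0 (Ne.symm hc)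
    set S : ℝ := x 0 ^ 2 * e 1 * e 2 * e 3 + x 1 ^ 2 * e 0 * e 2 * e 3 + x 2 ^ 2 * e 0 * e 1 * e 3
      + x 3 ^ 2 * e 0 * e 1 * e 2 with hS_def
    have hS : 1 ≤ S / c := by
      rw [le_div_iff₀ hcpos, one_mul]
      have h123 : 1 ≤ e 1 * e 2 * e 3 :=
        one_le_mul_of_one_le_of_one_le (one_le_mul_of_one_le_of_one_le (he 1) (he 2)) (he 3)
      have h023 : 1 ≤ e 0 * e 2 * e 3 :=
        one_le_mul_of_one_le_of_one_le (one_le_mul_of_one_le_of_one_le (he 0) (he 2)) (he 3)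
      have h013 : 1 ≤ e 0 * e 1 * e 3 :=
        one_le_mul_of_one_le_of_one_le (one_le_mul_of_one_le_of_one_le (he 0) (he 1)) (he 3)
      have h012 : 1 ≤ e 0 * e 1 * e 2 :=
        one_le_mul_of_one_le_of_one_le (one_le_mul_of_one_le_of_one_le (he 0) (he 1)) (he 2)
      have hc4 : c = x 0 ^ 2 + x 1 ^ 2 + x 2 ^ 2 + x 3 ^ 2 := by simp [hc_def, Fin.sum_univ_four]
      rw [hc4, hS_def]
      nlinarith [sq_nonneg (x 0), sq_nonneg (x 1), sq_nonneg (x 2), sq_nonneg (x 3)]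
    have hcC : csq (toC x) = (c : ℂ) := csq_toC x
    have heq : 1 + ghat (toC x) = ((S / c : ℝ) : ℂ) := by
      have hcne : (c : ℂ) ≠ 0 := by exact_mod_cast hc
      have h2 : (c : ℂ) * (1 + ghat (toC x)) = (S : ℂ) := by
        rw [← hcC, ← hden, hS_def]
        simp only [hE, toC]
        push_cast; ring
      rw [Complex.ofReal_div]
      field_simp
      linear_combination h2
    rw [heq]
    exact_mod_cast (by linarith : S / c ≠ 0)

/-! ## §3. The real cell is compact; a uniform tube on which `e_j`, `1 + g` are invertible -/

/-- The closed real period cell `{p : Im p_j = 0, |Re p_j| ≤ π}` of (3.2). [cite: FederbushWilliamson1987PhaseCellII, (3.2)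
p. 1417] -/
def realCell : Set Momentum := {p | ∀ j, (p j).im = 0 ∧ |(p j).re| ≤ π}

/-- (plumbing) the real cell is compact (closed and bounded in `ℂ⁴`). [cite: FederbushWilliamson1987PhaseCellII, (3.2)
p. 1417] -/
theorem isCompact_realCell : IsCompact realCell := by
  have hcl : IsClosed realCell := by
    have e : realCell = ⋂ j : Fin 4, {p : Momentum | (p j).im = 0} ∩ {p | |(p j).re| ≤ π} := by
      ext p; simp [realCell]
    rw [e]
    refine isClosed_iInter fun j => IsClosed.inter ?_ ?_
    · exact isClosed_eq (Complex.continuous_im.comp (continuous_apply j)) continuous_const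
    · exact isClosed_le (continuous_abs.comp (Complex.continuous_re.comp (continuous_apply j))) continuous_const
  have hbd : Bornology.IsBounded realCell := by
    refine (Metric.isBounded_closedBall (x := (0 : Momentum)) (r := 4)).subset fun p hp => ?_
    rw [Metric.mem_closedBall, dist_zero_right, pi_norm_le_iff_of_nonneg (by norm_num)]
    intro j
    have h := Complex.norm_le_abs_re_add_abs_im (p j)
    rw [(hp j).1, abs_zero, add_zero] at h
    exact h.trans ((hp j).2.trans (by linarith [Real.pi_lt_d2]))
  exact Metric.isCompact_of_isClosed_isBounded hcl hbd

/-- (plumbing) a point of the real cell is a real momentum `toC x`. [cite: FederbushWilliamson1987PhaseCellII, (3.2) p. 1417] -/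
theorem eq_toC_of_mem_realCell {p : Momentum} (hp : p ∈ realCell) : p = toC fun j => (p j).re := by
  funext j
  apply Complex.ext
  · simp [toC]
  · simp [toC, (hp j).1]

/-- (plumbing) the real cell lies in the wide tube. [cite: FederbushWilliamson1987PhaseCellII, (3.2) p. 1417] -/
theorem realCell_subset_Wt : realCell ⊆ Wt := fun p hp j =>
  ⟨(hp j).2.trans_lt (by linarith), by rw [(hp j).1, abs_zero]; norm_num⟩

/-- The set of points of the wide tube where all `e_j` and `1 + g` are non-zero is OPEN (continuity on `Wt`).
[cite: FederbushWilliamson1987PhaseCellII, (6.3), (6.13) p. 1418] -/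
theorem isOpen_goodSet :
    IsOpen {q : Momentum | q ∈ Wt ∧ (∀ j, E j q ≠ 0) ∧ 1 + ghat q ≠ 0} := by
  have hE : ∀ j, IsOpen (Wt ∩ E j ⁻¹' {z : ℂ | z ≠ 0}) := fun j =>
    (differentiableOn_E_Wt j).continuousOn.isOpen_inter_preimage isOpen_Wt isOpen_ne
  have hg : IsOpen (Wt ∩ (fun q => 1 + ghat q) ⁻¹' {z : ℂ | z ≠ 0}) :=
    ((differentiableOn_const (1 : ℂ)).add differentiableOn_ghat_Wt).continuousOn.isOpen_inter_preimage
      isOpen_Wt isOpen_ne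
  have e : {q : Momentum | q ∈ Wt ∧ (∀ j, E j q ≠ 0) ∧ 1 + ghat q ≠ 0} =
      (⋂ j, (Wt ∩ E j ⁻¹' {z : ℂ | z ≠ 0})) ∩ (Wt ∩ (fun q => 1 + ghat q) ⁻¹' {z : ℂ | z ≠ 0}) := by
    ext q
    simp only [Set.mem_setOf_eq, Set.mem_inter_iff, Set.mem_iInter, Set.mem_preimage]
    constructor
    · rintro ⟨hW, hE, hg⟩; exact ⟨fun j => ⟨hW, hE j⟩, hW, hg⟩
    · rintro ⟨h1, hW, hg⟩; exact ⟨hW, fun j => (h1 j).2, hg⟩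
  rw [e]
  exact (isOpen_iInter_of_finite hE).inter hg

/-- (plumbing) the real cell lies in the good set. [cite: FederbushWilliamson1987PhaseCellII, (6.3), (6.13) p. 1418] -/
theorem realCell_subset_goodSet :
    realCell ⊆ {q : Momentum | q ∈ Wt ∧ (∀ j, E j q ≠ 0) ∧ 1 + ghat q ≠ 0} := by
  intro p hp
  refine ⟨realCell_subset_Wt hp, ?_, ?_⟩
  · intro j; rw [eq_toC_of_mem_realCell hp]; exact E_toC_ne_zero j _
  · rw [eq_toC_of_mem_realCell hp]; exact one_add_ghat_toC_ne_zero _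

/-- (plumbing) clamping a real number to `[−π, π]` moves it by at most its excess over `π`. [folklore] -/
private theorem abs_sub_clamp_lt {x δ : ℝ} (hδ : 0 < δ) (hx : |x| < π + δ) : |x - max (-π) (min π x)| < δ ∧
    |max (-π) (min π x)| ≤ π := by
  rcases le_or_gt x π with h1 | h1
  · rw [min_eq_right h1]
    rcases le_or_gt (-π) x with h2 | h2
    · rw [max_eq_right h2, sub_self, abs_zero]
      exact ⟨hδ, abs_le.mpr ⟨h2, h1⟩⟩
    · rw [max_eq_left h2.le]
      have : |x| = -x := abs_of_neg (by linarith [Real.pi_pos])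
      refine ⟨?_, by rw [abs_neg, abs_of_pos Real.pi_pos]⟩
      rw [abs_of_neg (by linarith)]; linarith
  · rw [min_eq_left h1.le, max_eq_right (by linarith [Real.pi_pos])]
    have : |x| = x := abs_of_pos (by linarith [Real.pi_pos])
    refine ⟨?_, by rw [abs_of_pos Real.pi_pos]⟩
    rw [abs_of_pos (by linarith)]; linarith

/-- (plumbing) a tube of width `δ` lies in the `2δ`-thickening of the real cell (clamp the real parts).
[cite: FederbushWilliamson1987PhaseCellII, (3.2) p. 1417] -/
theorem tube_subset_thickening {δ : ℝ} (hδ : 0 < δ) : tube δ ⊆ Metric.thickening (2 * δ) realCell := by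
  intro q hq
  rw [Metric.mem_thickening_iff]
  set k : Momentum := fun j => ((max (-π) (min π (q j).re) : ℝ) : ℂ) with hk
  have hkj : ∀ j, k j = ((max (-π) (min π (q j).re) : ℝ) : ℂ) := fun j => rfl
  refine ⟨k, fun j => ⟨by rw [hkj, Complex.ofReal_im], ?_⟩, ?_⟩
  · rw [hkj, Complex.ofReal_re]; exact (abs_sub_clamp_lt hδ (hq j).1).2
  · rw [dist_pi_lt_iff (by linarith)]
    intro j
    rw [dist_eq_norm]
    have h := Complex.norm_le_abs_re_add_abs_im (q j - k j)
    have hre : (q j - k j).re = (q j).re - max (-π) (min π (q j).re) := by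
      rw [Complex.sub_re, hkj, Complex.ofReal_re]
    have him : (q j - k j).im = (q j).im := by rw [Complex.sub_im, hkj, Complex.ofReal_im, sub_zero]
    rw [hre, him] at h
    have h1 := (abs_sub_clamp_lt hδ (hq j).1).1
    have h2 := (hq j).2
    linarith

/-- **A uniform tube of invertibility**: there is `δ ∈ (0, ¼]` such that all `e_j(q) ≠ 0` and `1 + g(q) ≠ 0` on the tube
`{|Re q_j| < π + δ, |Im q_j| < δ}` — «e₁(p) is invertible in 𝒟_L … (1 + g) is invertible» ((6.3), (6.13)), by positivity
on the compact real cell and continuity (thickening). [cite: FederbushWilliamson1987PhaseCellII, (6.3), (6.13) p. 1418] -/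
theorem exists_delta : ∃ δ : ℝ, 0 < δ ∧ δ ≤ 1 / 4 ∧ ∀ q ∈ tube δ, (∀ j, E j q ≠ 0) ∧ 1 + ghat q ≠ 0 := by
  obtain ⟨δ₁, hδ₁, hsub⟩ := isCompact_realCell.exists_thickening_subset_open isOpen_goodSet realCell_subset_goodSet
  refine ⟨min (δ₁ / 2) (1 / 4), lt_min (by linarith) (by norm_num), min_le_right _ _, fun q hq => ?_⟩
  have hq' : q ∈ tube (δ₁ / 2) := tube_mono (min_le_left _ _) hq
  have h := hsub ((Metric.thickening_mono (by linarith) realCell) (tube_subset_thickening (by linarith) hq'))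
  exact ⟨h.2.1, h.2.2⟩

/-- **`δ₀`** — the width of the tube of Theorem 3.1 for the corrected-gauge mode (the `ε₀` of (3.2); obtained by compactness,
no explicit value). [cite: FederbushWilliamson1987PhaseCellII, Theorem 3.1 (3.2) p. 1417] -/
def delta0 : ℝ := Classical.choose exists_delta

/-- `0 < δ₀`. [cite: FederbushWilliamson1987PhaseCellII, Theorem 3.1 (3.2) p. 1417] -/
theorem delta0_pos : 0 < delta0 := (Classical.choose_spec exists_delta).1

/-- `δ₀ ≤ ¼`. [cite: FederbushWilliamson1987PhaseCellII, Theorem 3.1 (3.2) p. 1417] -/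
theorem delta0_le : delta0 ≤ 1 / 4 := (Classical.choose_spec exists_delta).2.1

/-- (plumbing) `tube δ₀ ⊆ Wt`. [cite: FederbushWilliamson1987PhaseCellII, (3.2) p. 1417] -/
theorem tube_delta0_subset_Wt : tube delta0 ⊆ Wt := tube_subset_Wt (delta0_le.trans (by norm_num))

/-- **`e_j ≠ 0` on the tube `δ₀`** ((6.3)). [cite: FederbushWilliamson1987PhaseCellII, (6.3) p. 1418] -/
theorem E_ne_zero_of_mem_tube {q : Momentum} (hq : q ∈ tube delta0) (j : Fin 4) : E j q ≠ 0 :=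
  ((Classical.choose_spec exists_delta).2.2 q hq).1 j

/-- **`1 + g ≠ 0` on the tube `δ₀`** ((6.13)). [cite: FederbushWilliamson1987PhaseCellII, (6.13) p. 1418] -/
theorem one_add_ghat_ne_zero_of_mem_tube {q : Momentum} (hq : q ∈ tube delta0) : 1 + ghat q ≠ 0 :=
  ((Classical.choose_spec exists_delta).2.2 q hq).2

/-- `r₀ ≠ 0` on the tube `δ₀`. [cite: FederbushWilliamson1987PhaseCellII, (5.4), (5.10) p. 1418] -/
theorem r0_ne_zero_of_mem_tube {q : Momentum} (hq : q ∈ tube delta0) : r0 q ≠ 0 :=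
  r0_ne_zero_Wt (tube_delta0_subset_Wt hq)

/-- `Re(1 + q²) ≥ ¾` on any tube of width `≤ ¼`, so `1 + q² ≠ 0` there. [cite: FederbushWilliamson1987PhaseCellII, (2.5)
p. 1417, (6.10) p. 1418] -/
theorem one_add_csq_ne_zero_of_mem_tube {δ : ℝ} (hδ : δ ≤ 1 / 4) {q : Momentum} (hq : q ∈ tube δ) : 1 + csq q ≠ 0 := by
  have him : ∀ l, (q l).im ^ 2 ≤ 1 / 16 := fun l => by
    have h1 : |(q l).im| ≤ 1 / 4 := (hq l).2.le.trans hδ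
    nlinarith [abs_nonneg ((q l).im), sq_abs ((q l).im)]
  have hre : (1 + csq q).re ≥ 3 / 4 := by
    rw [Complex.add_re, Complex.one_re]
    unfold csq
    rw [Complex.re_sum]
    have : ∀ l, ((q l) ^ 2).re = (q l).re ^ 2 - (q l).im ^ 2 := fun l => by rw [pow_two, Complex.mul_re]; ring
    simp_rw [this]
    rw [Fin.sum_univ_four]
    nlinarith [him 0, him 1, him 2, him 3, sq_nonneg (q 0).re, sq_nonneg (q 1).re, sq_nonneg (q 2).re,
      sq_nonneg (q 3).re]
  intro h
  rw [h, Complex.zero_re] at hre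
  linarith

/-! ## §4. The translated cells (`m ≠ 0`) and holomorphy of the representatives -/

/-- On a translated cell `m ≠ 0` (width `δ ≤ ½`): `Re p² ≥ 5`. [cite: FederbushWilliamson1987PhaseCellII, (3.1) p. 1417,
(6.10) p. 1418] -/
theorem re_csq_ge_of_mem_cellSet {m : Idx} (hm : m ≠ 0) {δ : ℝ} (hδ : δ ≤ 1 / 2) {p : Momentum} (hp : p ∈ cellSet m δ) :
    5 ≤ (csq p).re := by
  have h := re_csq_shift_ge (tube_subset_Wt hδ hp) hm
  rwa [shift_unshift] at h

/-- On a translated cell `m ≠ 0`: `‖p²‖ ≥ 5`, so `p² ≠ 0`. [cite: FederbushWilliamson1987PhaseCellII, (3.1) p. 1417] -/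
theorem norm_csq_ge_of_mem_cellSet {m : Idx} (hm : m ≠ 0) {δ : ℝ} (hδ : δ ≤ 1 / 2) {p : Momentum}
    (hp : p ∈ cellSet m δ) : 5 ≤ ‖csq p‖ :=
  (re_csq_ge_of_mem_cellSet hm hδ hp).trans (Complex.re_le_norm _)

/-- (plumbing) `p² ≠ 0` on a translated cell `m ≠ 0`. [cite: FederbushWilliamson1987PhaseCellII, (3.1) p. 1417] -/
theorem csq_ne_zero_of_mem_cellSet {m : Idx} (hm : m ≠ 0) {δ : ℝ} (hδ : δ ≤ 1 / 2) {p : Momentum}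
    (hp : p ∈ cellSet m δ) : csq p ≠ 0 := by
  intro h; have := norm_csq_ge_of_mem_cellSet hm hδ hp; rw [h, norm_zero] at this; linarith

/-- On a translated cell `m ≠ 0`: `Re(1 + p²) ≥ 6`, so `‖1 + p²‖ ≥ 6` and `1 + p² ≠ 0`.
[cite: FederbushWilliamson1987PhaseCellII, (2.5), (3.1) p. 1417] -/
theorem norm_one_add_csq_ge_of_mem_cellSet {m : Idx} (hm : m ≠ 0) {δ : ℝ} (hδ : δ ≤ 1 / 2) {p : Momentum}
    (hp : p ∈ cellSet m δ) : 6 ≤ ‖1 + csq p‖ := by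
  have h := re_csq_ge_of_mem_cellSet hm hδ hp
  have : 6 ≤ (1 + csq p).re := by rw [Complex.add_re, Complex.one_re]; linarith
  exact this.trans (Complex.re_le_norm _)

/-- (plumbing) `1 + p² ≠ 0` on a translated cell `m ≠ 0`. [cite: FederbushWilliamson1987PhaseCellII, (2.5), (3.1) p. 1417] -/
theorem one_add_csq_ne_zero_of_mem_cellSet {m : Idx} (hm : m ≠ 0) {δ : ℝ} (hδ : δ ≤ 1 / 2) {p : Momentum}
    (hp : p ∈ cellSet m δ) : 1 + csq p ≠ 0 := by
  intro h; have := norm_one_add_csq_ge_of_mem_cellSet hm hδ hp; rw [h, norm_zero] at this; linarith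

/-- On a translated cell: `|Re p_j| ≥ (5/2)|m_j|` for `m_j ≠ 0`, so `p_j ≠ 0`. [cite: FederbushWilliamson1987PhaseCellII,
(3.1) p. 1417] -/
theorem abs_re_ge_of_mem_cellSet {m : Idx} {j : Fin 4} (hmj : m j ≠ 0) {δ : ℝ} (hδ : δ ≤ 1 / 2) {p : Momentum}
    (hp : p ∈ cellSet m δ) : 5 / 2 * |(m j : ℝ)| ≤ |(p j).re| := by
  have h := abs_shift_re_ge (tube_subset_Wt hδ hp) (n := m) hmj
  rwa [shift_unshift] at h

/-- (plumbing) `p_j ≠ 0` on a translated cell when `m_j ≠ 0`. [cite: FederbushWilliamson1987PhaseCellII, (3.1) p. 1417] -/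
theorem apply_ne_zero_of_mem_cellSet {m : Idx} {j : Fin 4} (hmj : m j ≠ 0) {δ : ℝ} (hδ : δ ≤ 1 / 2) {p : Momentum}
    (hp : p ∈ cellSet m δ) : p j ≠ 0 := by
  intro h
  have h1 := abs_re_ge_of_mem_cellSet hmj hδ hp
  rw [h, Complex.zero_re, abs_zero] at h1
  have h2 : (1 : ℝ) ≤ |(m j : ℝ)| := by rw [← Int.cast_abs]; exact_mod_cast Int.one_le_abs hmj
  linarith

/-- (plumbing) `λ_j(m,·)` is holomorphic on the translated cell. [cite: FederbushWilliamson1987PhaseCellII, (3.1) p. 1417] -/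
theorem differentiableOn_lam (m : Idx) (j : Fin 4) {δ : ℝ} (hδ : δ ≤ 1 / 2) :
    DifferentiableOn ℂ (lam m j) (cellSet m δ) := by
  by_cases hmj : m j = 0
  · have : lam m j = fun _ => 1 := funext fun p => lam_of_eq_zero hmj p
    rw [this]; exact differentiableOn_const _
  · unfold lam
    exact (differentiableOn_const _).sub (differentiableOn_div (differentiableOn_const _)
      (differentiable_apply j).differentiableOn fun p hp => apply_ne_zero_of_mem_cellSet hmj hδ hp)

/-- (plumbing) the (6.14)-indexed `Q_i` are holomorphic on the wide tube. [cite: FederbushWilliamson1987PhaseCellII, (6.14)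
p. 1418] -/
theorem differentiableOn_Qo (i : Fin 4) : DifferentiableOn ℂ (Qo i) Wt := by
  obtain ⟨h0, h1, h2, h3⟩ := differentiableOn_Q_Wt
  have e : Qo i = fun p => if i = 0 then Q0 p else if i = 1 then Q1 p else if i = 2 then Q2 p else Q3 p := rfl
  fin_cases i
  · exact h0.congr fun p _ => by simp [Qo]
  · exact h1.congr fun p _ => by simp [Qo]
  · exact h2.congr fun p _ => by simp [Qo]
  · exact h3.congr fun p _ => by simp [Qo]

/-- (plumbing) `gs_s` is entire. [cite: FederbushWilliamson1987PhaseCellII, (2.5) p. 1417] -/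
theorem differentiable_gs (s : ℕ) : Differentiable ℂ (gs s) := by
  have e : gs s = fun p => ∑ k ∈ Finset.range s, (1 + csq p) ^ k := rfl
  rw [e]
  exact Differentiable.fun_sum fun k _ => ((differentiable_const _).add differentiable_csq).pow k

/-- (plumbing) `Ω_{s,i}` is holomorphic on the wide tube. [cite: FederbushWilliamson1987PhaseCellII, (5.8)–(5.10) p. 1418] -/
theorem differentiableOn_Om (s : ℕ) (i : Fin 4) : DifferentiableOn ℂ (Om s i) Wt := by
  have hQ := differentiableOn_Qo i
  have hg := (differentiable_gs s).differentiableOn (s := Wt)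
  have hc : DifferentiableOn ℂ csq Wt := differentiable_csq.differentiableOn
  unfold Om
  exact (hQ.add hg).add ((hc.mul hQ).mul hg)

/-- (plumbing) the numerator `num0_{s,i}` is holomorphic on the wide tube. [cite: FederbushWilliamson1987PhaseCellII,
(5.5)–(5.10) p. 1418] -/
theorem differentiableOn_num0 (s : ℕ) (i : Fin 4) : DifferentiableOn ℂ (num0 s i) Wt := by
  have hc : DifferentiableOn ℂ csq Wt := differentiable_csq.differentiableOn
  have hap : ∀ j : Fin 4, DifferentiableOn ℂ (fun p : Momentum => p j) Wt := fun j =>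
    (differentiable_apply j).differentiableOn
  by_cases hi : i = 0
  · subst hi
    have e : num0 s 0 = fun p => (1 + ghat p) * (1 + csq p) ^ s - (p 0) ^ 2 * Om s 0 p := by
      funext p; simp [num0]
    rw [e]
    exact (((differentiableOn_const _).add differentiableOn_ghat_Wt).mul (((differentiableOn_const _).add hc).pow s)).sub
      (((hap 0).pow 2).mul (differentiableOn_Om s 0))
  · have e : num0 s i = fun p => -(p 0 * p i * Om s i p) := by
      funext p; simp [num0, hi]
    rw [e]
    exact (((hap 0).mul (hap i)).mul (differentiableOn_Om s i)).neg

/-- **The cell-`0` representative is holomorphic on the tube `δ₀`.** [cite: FederbushWilliamson1987PhaseCellII, Theorem 3.1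
p. 1417, (5.10), (6.1)–(6.4) p. 1418] -/
theorem differentiableOn_G0 (s : ℕ) (i : Fin 4) : DifferentiableOn ℂ (G0 s i) (tube delta0) := by
  have hW := tube_delta0_subset_Wt
  have hc : DifferentiableOn ℂ csq (tube delta0) := differentiable_csq.differentiableOn
  have hnum : DifferentiableOn ℂ (fun p => Phi p * num0 s i p) (tube delta0) :=
    ((analyticOnNhd_Phi _).differentiableOn).mul ((differentiableOn_num0 s i).mono hW)
  have hden : DifferentiableOn ℂ (fun p => r0 p * E 0 p * (1 + ghat p) * (1 + csq p) ^ s) (tube delta0) :=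
    ((((analyticOnNhd_r0 _).differentiableOn).mul ((differentiableOn_E_Wt 0).mono hW)).mul
      (((differentiableOn_const _).add (differentiableOn_ghat_Wt.mono hW)))).mul (((differentiableOn_const _).add hc).pow s)
  have hne : ∀ p ∈ tube delta0, r0 p * E 0 p * (1 + ghat p) * (1 + csq p) ^ s ≠ 0 := fun p hp =>
    mul_ne_zero (mul_ne_zero (mul_ne_zero (r0_ne_zero_of_mem_tube hp) (E_ne_zero_of_mem_tube hp 0))
      (one_add_ghat_ne_zero_of_mem_tube hp)) (pow_ne_zero _ (one_add_csq_ne_zero_of_mem_tube delta0_le hp))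
  unfold G0
  exact differentiableOn_div hnum hden hne

/-- **The cell-`0` representative is ANALYTIC on the tube `δ₀`** (Theorem 3.1's conclusion for it).
[cite: FederbushWilliamson1987PhaseCellII, Theorem 3.1 p. 1417] -/
theorem analyticOnNhd_G0 (s : ℕ) (i : Fin 4) : AnalyticOnNhd ℂ (G0 s i) (tube delta0) :=
  Literature.Analysis.Complex.SCV.analyticOnNhd_of_differentiableOn (differentiableOn_G0 s i) (isOpen_tube _)

/-- (plumbing) composing a function holomorphic on the tube with `p ↦ p − 2πm` gives a function holomorphic on the cell.
[cite: FederbushWilliamson1987PhaseCellII, (3.1) p. 1417] -/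
theorem differentiableOn_comp_unshift {f : Momentum → ℂ} {δ : ℝ} (hf : DifferentiableOn ℂ f (tube δ)) (m : Idx) :
    DifferentiableOn ℂ (fun p => f (unshift m p)) (cellSet m δ) :=
  hf.comp (differentiable_unshift m).differentiableOn fun _ hp => hp

/-- (plumbing) the periodic numerators `ν_i` are holomorphic on the tube `δ₀`. [cite: FederbushWilliamson1987PhaseCellII,
(5.5)–(5.6) p. 1418] -/
theorem differentiableOn_num1 (i : Fin 4) : DifferentiableOn ℂ (num1 i) (tube delta0) := by
  have hW := tube_delta0_subset_Wt
  have hap : ∀ j : Fin 4, DifferentiableOn ℂ (fun p : Momentum => p j) (tube delta0) := fun j =>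
    (differentiable_apply j).differentiableOn
  have hE : ∀ j, DifferentiableOn ℂ (E j) (tube delta0) := fun j => (differentiableOn_E_Wt j).mono hW
  by_cases hi : i = 0
  · subst hi
    have e : num1 0 = Nn := by funext p; simp [num1]
    rw [e]
    unfold Nn
    exact (((((hap 3).pow 2).mul (hE 1)).mul (hE 2)).add ((((hap 2).pow 2).mul (hE 1)).mul (hE 3))).add
      ((((hap 1).pow 2).mul (hE 2)).mul (hE 3))
  · have e : num1 i = fun q => -(q 0 * q i * Eo i q) := by funext q; simp [num1, hi]
    rw [e]
    have hEo : DifferentiableOn ℂ (Eo i) (tube delta0) := by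
      unfold Eo
      exact differentiableOn_div (((hE 1).mul (hE 2)).mul (hE 3)) (hE i) fun q hq => E_ne_zero_of_mem_tube hq i
    exact (((hap 0).mul (hap i)).mul hEo).neg

/-- **The cell-`m` representative is holomorphic on the translated cell, `m ≠ 0`.** [cite: FederbushWilliamson1987PhaseCellII,
Theorem 3.2 p. 1417, (3.1) p. 1417, (6.1)–(6.4) p. 1418] -/
theorem differentiableOn_Gm (s : ℕ) {m : Idx} (hm : m ≠ 0) (i : Fin 4) :
    DifferentiableOn ℂ (Gm s m i) (cellSet m delta0) := by
  have hδ : delta0 ≤ 1 / 2 := delta0_le.trans (by norm_num)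
  have hPhi : DifferentiableOn ℂ Phi (cellSet m delta0) := (analyticOnNhd_Phi _).differentiableOn
  have hr0p : DifferentiableOn ℂ r0 (cellSet m delta0) := (analyticOnNhd_r0 _).differentiableOn
  have hlam : ∀ j, DifferentiableOn ℂ (lam m j) (cellSet m delta0) := fun j => differentiableOn_lam m j hδ
  have hc : DifferentiableOn ℂ csq (cellSet m delta0) := differentiable_csq.differentiableOn
  have hap : ∀ j : Fin 4, DifferentiableOn ℂ (fun p : Momentum => p j) (cellSet m delta0) := fun j =>
    (differentiable_apply j).differentiableOn
  -- the `q`-dependent pieces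
  have hq0 : DifferentiableOn ℂ (fun p => unshift m p 0) (cellSet m delta0) :=
    differentiableOn_comp_unshift ((differentiable_apply 0).differentiableOn) m
  have hnum1 : DifferentiableOn ℂ (fun p => num1 i (unshift m p)) (cellSet m delta0) :=
    differentiableOn_comp_unshift (differentiableOn_num1 i) m
  have hr0q : DifferentiableOn ℂ (fun p => r0 (unshift m p)) (cellSet m delta0) :=
    differentiableOn_comp_unshift ((analyticOnNhd_r0 _).differentiableOn) m
  have hE0q : DifferentiableOn ℂ (fun p => E 0 (unshift m p)) (cellSet m delta0) :=
    differentiableOn_comp_unshift ((differentiableOn_E_Wt 0).mono tube_delta0_subset_Wt) m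
  have hgq : DifferentiableOn ℂ (fun p => 1 + ghat (unshift m p)) (cellSet m delta0) :=
    differentiableOn_comp_unshift ((differentiableOn_const _).add (differentiableOn_ghat_Wt.mono tube_delta0_subset_Wt)) m
  have hcq : DifferentiableOn ℂ (fun p => csq (unshift m p)) (cellSet m delta0) :=
    differentiableOn_comp_unshift differentiable_csq.differentiableOn m
  -- non-vanishing of the denominators
  have hne1 : ∀ p ∈ cellSet m delta0, csq p * r0 (unshift m p) * (1 + ghat (unshift m p)) ≠ 0 := fun p hp =>
    mul_ne_zero (mul_ne_zero (csq_ne_zero_of_mem_cellSet hm hδ hp) (r0_ne_zero_of_mem_tube hp))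
      (one_add_ghat_ne_zero_of_mem_tube hp)
  have hne2 : ∀ p ∈ cellSet m delta0, csq p ^ 4 * r0 (unshift m p) ^ 4 * E 0 (unshift m p) *
      (1 + ghat (unshift m p)) * (1 + csq p) ^ s ≠ 0 := fun p hp =>
    mul_ne_zero (mul_ne_zero (mul_ne_zero (mul_ne_zero (pow_ne_zero _ (csq_ne_zero_of_mem_cellSet hm hδ hp))
      (pow_ne_zero _ (r0_ne_zero_of_mem_tube hp))) (E_ne_zero_of_mem_tube hp 0)) (one_add_ghat_ne_zero_of_mem_tube hp))
      (pow_ne_zero _ (one_add_csq_ne_zero_of_mem_cellSet hm hδ hp))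
  have hprod : DifferentiableOn ℂ (fun p => ∏ j, lam m j p ^ 2) (cellSet m delta0) := by
    simp only [Fin.prod_univ_four]
    exact ((((hlam 0).pow 2).mul ((hlam 1).pow 2)).mul ((hlam 2).pow 2)).mul ((hlam 3).pow 2)
  unfold Gm
  refine DifferentiableOn.add ?_ ?_
  · exact differentiableOn_div ((((hPhi.mul (hlam 0)).mul (hlam i)).mul hnum1)) ((hc.mul hr0q).mul hgq) hne1
  · exact differentiableOn_div ((((((hPhi.mul (hlam 0)).mul hq0).mul (hap i)).mul (hcq.pow 3)).mul (hr0p.pow 3)).mul hprod)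
      (((((hc.pow 4).mul (hr0q.pow 4)).mul hE0q).mul hgq).mul (((differentiableOn_const _).add hc).pow s)) hne2

/-- **The cell-`m` representative is ANALYTIC on the translated cell, `m ≠ 0`** (Theorem 3.2's conclusion, cell by cell).
[cite: FederbushWilliamson1987PhaseCellII, Theorem 3.2 p. 1417] -/
theorem analyticOnNhd_Gm (s : ℕ) {m : Idx} (hm : m ≠ 0) (i : Fin 4) : AnalyticOnNhd ℂ (Gm s m i) (cellSet m delta0) :=
  Literature.Analysis.Complex.SCV.analyticOnNhd_of_differentiableOn (differentiableOn_Gm s hm i) (isOpen_cellSet _ _)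

end ModeAnalyticityCellPositivity

end Literature.MathematicalPhysics.QuantumFieldTheory.Federbush1986
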